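import Mathlib
import HarnessLib
import Literature.MathematicalPhysics.QuantumFieldTheory.ConstructiveQFTWave0

/-!
# Light cones on the torus: `r`-neighbourhoods of sites by integer representatives, `K` one-local layers make a `K`-local member, and the CROSS IDENTITIES — a one-link change outside the cone does not see a change inside (Wilson action and running density)

HONEST FRAMING: exact (Metropolis-corrected) sampling algorithms for lattice gauge theory;
figures of merit are autocorrelation/cost numbers at stated couplings and volumes; no
continuum-physics claim.

Venture `LatticeQCDFlow` (cell pub-lqcd), topic `Exactness`; FANOUT row 14 (`eng-flowhmc`, engine
`latflow.fthmc`, family B, on the periodic torus `Site d L = (Fin d → ZMod L)` of the Literature's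
`ConstructiveQFTWave0`).  NEW WORK of the cell; nothing is cited as a fact; no number.  Fifth file of
the VOLUME-UNIFORMITY chain (GEN-15), the group-agnostic half of the LOCALITY step: the exact force of
FT-HMC through a member `F = F_K ∘ ⋯ ∘ F_1` of one-local layers at a link `l₀` only reads the field in a
light cone around `l₀`, ON EVERY TORUS — no size condition, because neighbourhoods are phrased through
integer representatives and may wrap.

## Vocabulary (all VERBATIM, no definition is introduced)

* `y` is `r`-NEAR `x`:  `∃ z : Fin d → ℤ, (∀ i, |z i| ≤ r) ∧ y = x + (i ↦ (z i : ZMod L))`;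
* `V`, `W` AGREE on the `r`-ball at `x`:  `∀ e, e.1 r-near x → V e = W e`;
* `V'` is `V` OFF the `s`-ball at `x`:  `∀ e, ¬(e.1 s-near x) → V' e = V e`;
* a map `f` of fields is ONE-LOCAL:  agreement on the `(r+1)`-ball at `x` ⇒ agreement of the images on
  the `r`-ball at `x` (every `x`, `r`);
* a density `J` satisfies the CROSS IDENTITY:  for `s + 2 ≤ r`, if `A', B'` agree on the `r`-ball at
  `x₀`, `A, B` agree there too, and `A'` is `A` off the `s`-ball, `B'` is `B` off the `s`-ball, then
  `J A' · J B = J A · J B'`.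

## Content

* §1 `near_refl`, `near_triangle`, `near_symm`, `near_mono`, `near_shift`, `near_sub_single`,
  `near_sub_single_shift` (the sites read by a staple are `1`-near);
* §2 layers (any link group `G`): `forall_mem_of_layers_map_eq'`, `length_eq_of_layers_map_eq`
  (transfer through the `layers.map … = sched.map …` packaging), `agree_of_radius_eq`, `off_of_radius_eq`,
  **`foldr_local`** (`K` one-local layers
  ⇒ agreement on the `(r+K)`-ball gives agreement of `F_K ∘ ⋯ ∘ F_1` on the `r`-ball), `agree_of_off`,
  `local_off` / **`foldr_off`** (a change off the `s`-ball stays off the `(s+K)`-ball),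
  **`foldr_logDet_cross`** (the running density `J_1(v)·J_2(F_1 v)⋯` satisfies
  `J(A')·J(B) = J(A)·J(B')` when the balls have radius `s + 2K + e`);
* §3 any group, any matrix representation: `plaquetteHolonomy_congr`, **`wilsonAction_cross`**
  (`S_W(A') − S_W(B') = S_W(A) − S_W(B)` under the same hypotheses with `s + 2 ≤ r`).

NOT CLAIMED: sharp cones; anything metric about the torus beyond representatives; any number.
-/

noncomputable section

namespace Summit.Ventures.LatticeQCDFlow.Exactness

open Literature.MathematicalPhysics.QuantumFieldTheory

/-! ## §1 Neighbourhoods by integer representatives -/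

section Near

variable {d L : ℕ}

/-- `x` is `r`-near itself. -/
theorem near_refl (x : Site d L) (r : ℕ) : (∃ z : Fin d → ℤ, (∀ i, |z i| ≤ ((r : ℕ) : ℤ)) ∧ x = x + fun i => ((z i : ℤ) : ZMod L)) :=
  ⟨0, fun i => by simp, by funext i; simp⟩

/-- Triangle inequality for representatives: `r`-near then `s`-near is `(r+s)`-near. -/
theorem near_triangle {x y w : Site d L} {r s : ℕ} (h : (∃ z : Fin d → ℤ, (∀ i, |z i| ≤ ((r : ℕ) : ℤ)) ∧ y = x + fun i => ((z i : ℤ) : ZMod L))) (h' : (∃ z : Fin d → ℤ, (∀ i, |z i| ≤ ((s : ℕ) : ℤ)) ∧ w = y + fun i => ((z i : ℤ) : ZMod L))) :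
    (∃ z : Fin d → ℤ, (∀ i, |z i| ≤ (((r+s) : ℕ) : ℤ)) ∧ w = x + fun i => ((z i : ℤ) : ZMod L)) := by
  obtain ⟨z, hz, hy⟩ := h
  obtain ⟨z', hz', hw⟩ := h'
  refine ⟨z + z', fun i => ?_, ?_⟩
  · rw [Pi.add_apply, Nat.cast_add]
    exact (abs_add_le _ _).trans (add_le_add (hz i) (hz' i))
  · rw [hw, hy, add_assoc]
    congr 1
    funext i
    simp only [Pi.add_apply, Int.cast_add]

/-- Symmetry: `y` is `r`-near `x` iff `x` is `r`-near `y`. -/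
theorem near_symm {x y : Site d L} {r : ℕ} (h : (∃ z : Fin d → ℤ, (∀ i, |z i| ≤ ((r : ℕ) : ℤ)) ∧ y = x + fun i => ((z i : ℤ) : ZMod L))) : (∃ z : Fin d → ℤ, (∀ i, |z i| ≤ ((r : ℕ) : ℤ)) ∧ x = y + fun i => ((z i : ℤ) : ZMod L)) := by
  obtain ⟨z, hz, hy⟩ := h
  refine ⟨-z, fun i => by rw [Pi.neg_apply, abs_neg]; exact hz i, ?_⟩
  rw [hy]
  funext i
  simp only [Pi.add_apply, Pi.neg_apply, Int.cast_neg, add_neg_cancel_right]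

/-- Monotonicity in the radius. -/
theorem near_mono {x y : Site d L} {r r' : ℕ} (hr : r ≤ r') (h : (∃ z : Fin d → ℤ, (∀ i, |z i| ≤ ((r : ℕ) : ℤ)) ∧ y = x + fun i => ((z i : ℤ) : ZMod L))) : (∃ z : Fin d → ℤ, (∀ i, |z i| ≤ ((r' : ℕ) : ℤ)) ∧ y = x + fun i => ((z i : ℤ) : ZMod L)) := by
  obtain ⟨z, hz, hy⟩ := h
  exact ⟨z, fun i => (hz i).trans (by exact_mod_cast hr), hy⟩

/-- `x + e_i` is `1`-near `x`. -/
theorem near_shift (x : Site d L) (i : Fin d) : (∃ z : Fin d → ℤ, (∀ i, |z i| ≤ ((1 : ℕ) : ℤ)) ∧ (Site.shift x i) = x + fun i => ((z i : ℤ) : ZMod L)) := by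
  refine ⟨Pi.single i 1, fun j => ?_, ?_⟩
  · by_cases h : j = i
    · subst h; simp
    · simp [h]
  · funext j
    by_cases h : j = i
    · subst h; simp [Site.shift]
    · simp [Site.shift, Pi.single_apply, h]

/-- `x − e_ν` is `1`-near `x`. -/
theorem near_sub_single (x : Site d L) (ν : Fin d) : (∃ z : Fin d → ℤ, (∀ i, |z i| ≤ ((1 : ℕ) : ℤ)) ∧ (x - Pi.single ν 1) = x + fun i => ((z i : ℤ) : ZMod L)) := by
  refine ⟨-Pi.single ν 1, fun j => ?_, ?_⟩
  · by_cases h : j = ν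
    · subst h; simp
    · simp [h]
  · funext j
    by_cases h : j = ν
    · subst h; simp [sub_eq_add_neg]
    · simp [Pi.single_apply, h]

/-- `x − e_ν + e_μ` is `1`-near `x`. -/
theorem near_sub_single_shift (x : Site d L) (ν μ : Fin d) :
    (∃ z : Fin d → ℤ, (∀ i, |z i| ≤ ((1 : ℕ) : ℤ)) ∧ (Site.shift (x - Pi.single ν 1) μ) = x + fun i => ((z i : ℤ) : ZMod L)) := by
  refine ⟨Pi.single μ 1 - Pi.single ν 1, fun j => ?_, ?_⟩
  · simp only [Pi.sub_apply, Pi.single_apply, Nat.cast_one]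
    split_ifs <;> simp
  · funext j
    simp only [Site.shift, Pi.add_apply, Pi.sub_apply, Pi.single_apply, Int.cast_sub]
    split_ifs <;> push_cast <;> ring

end Near

/-! ## §2 One-local layers, members, and the cross identity for the running density -/

section Layers

variable {d L : ℕ} {G : Type*} [MeasurableSpace G]

/-- **Transfer through the `exists_layers_*` packaging (one space, two predicates).**  If the layers'
maps and densities ARE position by position `Fm s`, `Jm s` of a schedule, a property of every `Fm s` and
a property of every `Jm s` hold for every layer. -/
theorem forall_mem_of_layers_map_eq' {Ω σ : Type*} [MeasurableSpace Ω] (layers : List ((Ω ≃ᵐ Ω) × (Ω → ℝ)))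
    (sched : List σ) (Fm : σ → Ω → Ω) (Jm : σ → Ω → ℝ)
    (hmap : layers.map (fun Ly => ((Ly.1 : Ω → Ω), Ly.2)) = sched.map (fun s => (Fm s, Jm s)))
    {P : (Ω → Ω) → Prop} {Q : (Ω → ℝ) → Prop} (hP : ∀ s ∈ sched, P (Fm s)) (hQ : ∀ s ∈ sched, Q (Jm s)) :
    ∀ Ly ∈ layers, P Ly.1 ∧ Q Ly.2 := by
  intro Ly hLy
  have hmem : ((Ly.1 : Ω → Ω), Ly.2) ∈ sched.map (fun s => (Fm s, Jm s)) := by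
    rw [← hmap]
    exact List.mem_map.mpr ⟨Ly, hLy, rfl⟩
  obtain ⟨s, hs, hEq⟩ := List.mem_map.mp hmem
  obtain ⟨h1, h2⟩ := Prod.mk.inj hEq
  exact ⟨h1 ▸ hP s hs, h2 ▸ hQ s hs⟩

/-- The number of layers is the length of the schedule. -/
theorem length_eq_of_layers_map_eq {Ω σ : Type*} [MeasurableSpace Ω] (layers : List ((Ω ≃ᵐ Ω) × (Ω → ℝ)))
    (sched : List σ) (Fm : σ → Ω → Ω) (Jm : σ → Ω → ℝ)
    (hmap : layers.map (fun Ly => ((Ly.1 : Ω → Ω), Ly.2)) = sched.map (fun s => (Fm s, Jm s))) :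
    layers.length = sched.length := by
  simpa using congrArg List.length hmap

omit [MeasurableSpace G] in
/-- Agreement on a ball, with the radius rewritten. -/
theorem agree_of_radius_eq {V W : GaugeConfig d L G} {x : Site d L} {r r' : ℕ} (hr : r = r')
    (h : (∀ e : Edge d L, (∃ z : Fin d → ℤ, (∀ i, |z i| ≤ ((r : ℕ) : ℤ)) ∧ e.1 = x + fun i => ((z i : ℤ) : ZMod L)) → V e = W e)) : (∀ e : Edge d L, (∃ z : Fin d → ℤ, (∀ i, |z i| ≤ ((r' : ℕ) : ℤ)) ∧ e.1 = x + fun i => ((z i : ℤ) : ZMod L)) → V e = W e) := by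
  subst hr
  exact h

omit [MeasurableSpace G] in
/-- "Off a ball", with the radius rewritten. -/
theorem off_of_radius_eq {V' V : GaugeConfig d L G} {x : Site d L} {s s' : ℕ} (hs : s = s')
    (h : (∀ e : Edge d L, ¬ (∃ z : Fin d → ℤ, (∀ i, |z i| ≤ ((s : ℕ) : ℤ)) ∧ e.1 = x + fun i => ((z i : ℤ) : ZMod L)) → V' e = V e)) : (∀ e : Edge d L, ¬ (∃ z : Fin d → ℤ, (∀ i, |z i| ≤ ((s' : ℕ) : ℤ)) ∧ e.1 = x + fun i => ((z i : ℤ) : ZMod L)) → V' e = V e) := by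
  subst hs
  exact h

/-- **A member of `K` one-local layers is `K`-local**: if `V`, `W` agree on the `(r+K)`-ball at `x`,
the composites `F_K ∘ ⋯ ∘ F_1` agree on the `r`-ball at `x`. -/
theorem foldr_local (layers : List ((GaugeConfig d L G ≃ᵐ GaugeConfig d L G) × (GaugeConfig d L G → ℝ)))
    (hloc : ∀ Ly ∈ layers, (∀ (U U' : GaugeConfig d L G) (x : Site d L) (r : ℕ),
      (∀ e : Edge d L, (∃ z : Fin d → ℤ, (∀ i, |z i| ≤ (((r+1) : ℕ) : ℤ)) ∧ e.1 = x + fun i => ((z i : ℤ) : ZMod L)) → U e = U' e) →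
      (∀ e : Edge d L, (∃ z : Fin d → ℤ, (∀ i, |z i| ≤ ((r : ℕ) : ℤ)) ∧ e.1 = x + fun i => ((z i : ℤ) : ZMod L)) → (Ly.1 U) e = (Ly.1 U') e)))
    (r : ℕ) (U U' : GaugeConfig d L G) (x : Site d L)
    (h : (∀ e : Edge d L, (∃ z : Fin d → ℤ, (∀ i, |z i| ≤ (((r+layers.length) : ℕ) : ℤ)) ∧ e.1 = x + fun i => ((z i : ℤ) : ZMod L)) → U e = U' e)) :
    (∀ e : Edge d L, (∃ z : Fin d → ℤ, (∀ i, |z i| ≤ ((r : ℕ) : ℤ)) ∧ e.1 = x + fun i => ((z i : ℤ) : ZMod L)) → ((layers.foldr (fun Ly (F : GaugeConfig d L G ≃ᵐ GaugeConfig d L G) => Ly.1.trans F) (MeasurableEquiv.refl (GaugeConfig d L G))) U) e = ((layers.foldr (fun Ly (F : GaugeConfig d L G ≃ᵐ GaugeConfig d L G) => Ly.1.trans F) (MeasurableEquiv.refl (GaugeConfig d L G))) U') e) := by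
  induction layers generalizing r U U' with
  | nil =>
    intro e he
    simp only [List.foldr_nil, MeasurableEquiv.refl_apply]
    exact h e (by simpa using he)
  | cons Ly rest ih =>
    intro e he
    simp only [List.foldr_cons, MeasurableEquiv.coe_trans, Function.comp_apply]
    have hr : r + (Ly :: rest).length = (r + rest.length) + 1 := by
      simp only [List.length_cons]; ring
    rw [hr] at h
    exact ih (fun L hL => hloc L (List.mem_cons_of_mem _ hL)) r (Ly.1 U) (Ly.1 U')
      (hloc Ly List.mem_cons_self U U' x (r + rest.length) h) e he

omit [MeasurableSpace G] in
/-- A change off the `s`-ball at `x₀` is invisible on the `1`-ball around any site not `(s+1)`-near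
`x₀`. -/
theorem agree_of_off {A A' : GaugeConfig d L G} {x₀ : Site d L} {s : ℕ} (h : (∀ e : Edge d L, ¬ (∃ z : Fin d → ℤ, (∀ i, |z i| ≤ ((s : ℕ) : ℤ)) ∧ e.1 = x₀ + fun i => ((z i : ℤ) : ZMod L)) → A' e = A e))
    {y : Site d L} (hy : ¬ (∃ z : Fin d → ℤ, (∀ i, |z i| ≤ (((s+1) : ℕ) : ℤ)) ∧ y = x₀ + fun i => ((z i : ℤ) : ZMod L))) :
    (∀ e : Edge d L, (∃ z : Fin d → ℤ, (∀ i, |z i| ≤ (((0+1) : ℕ) : ℤ)) ∧ e.1 = y + fun i => ((z i : ℤ) : ZMod L)) → A' e = A e) := by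
  intro e he
  refine h e fun hn => hy ?_
  simpa using near_triangle hn (near_symm he)

omit [MeasurableSpace G] in
/-- **One-local maps push a change outward by one**: if `A'` is `A` off the `s`-ball, `f A'` is `f A`
off the `(s+1)`-ball. -/
theorem local_off {f : GaugeConfig d L G → GaugeConfig d L G} (hf : (∀ (U U' : GaugeConfig d L G) (x : Site d L) (r : ℕ),
      (∀ e : Edge d L, (∃ z : Fin d → ℤ, (∀ i, |z i| ≤ (((r+1) : ℕ) : ℤ)) ∧ e.1 = x + fun i => ((z i : ℤ) : ZMod L)) → U e = U' e) →
      (∀ e : Edge d L, (∃ z : Fin d → ℤ, (∀ i, |z i| ≤ ((r : ℕ) : ℤ)) ∧ e.1 = x + fun i => ((z i : ℤ) : ZMod L)) → (f U) e = (f U') e)))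
    {A A' : GaugeConfig d L G} {x₀ : Site d L} {s : ℕ} (h : (∀ e : Edge d L, ¬ (∃ z : Fin d → ℤ, (∀ i, |z i| ≤ ((s : ℕ) : ℤ)) ∧ e.1 = x₀ + fun i => ((z i : ℤ) : ZMod L)) → A' e = A e)) :
    (∀ e : Edge d L, ¬ (∃ z : Fin d → ℤ, (∀ i, |z i| ≤ (((s+1) : ℕ) : ℤ)) ∧ e.1 = x₀ + fun i => ((z i : ℤ) : ZMod L)) → (f A') e = (f A) e) := fun e he =>
  hf A' A e.1 0 (agree_of_off h he) e (near_refl e.1 0)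

/-- **Members push a change outward by `K`**. -/
theorem foldr_off (layers : List ((GaugeConfig d L G ≃ᵐ GaugeConfig d L G) × (GaugeConfig d L G → ℝ)))
    (hloc : ∀ Ly ∈ layers, (∀ (U U' : GaugeConfig d L G) (x : Site d L) (r : ℕ),
      (∀ e : Edge d L, (∃ z : Fin d → ℤ, (∀ i, |z i| ≤ (((r+1) : ℕ) : ℤ)) ∧ e.1 = x + fun i => ((z i : ℤ) : ZMod L)) → U e = U' e) →
      (∀ e : Edge d L, (∃ z : Fin d → ℤ, (∀ i, |z i| ≤ ((r : ℕ) : ℤ)) ∧ e.1 = x + fun i => ((z i : ℤ) : ZMod L)) → (Ly.1 U) e = (Ly.1 U') e)))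
    {A A' : GaugeConfig d L G} {x₀ : Site d L} {s : ℕ} (h : (∀ e : Edge d L, ¬ (∃ z : Fin d → ℤ, (∀ i, |z i| ≤ ((s : ℕ) : ℤ)) ∧ e.1 = x₀ + fun i => ((z i : ℤ) : ZMod L)) → A' e = A e)) :
    (∀ e : Edge d L, ¬ (∃ z : Fin d → ℤ, (∀ i, |z i| ≤ (((s+layers.length) : ℕ) : ℤ)) ∧ e.1 = x₀ + fun i => ((z i : ℤ) : ZMod L)) → ((layers.foldr (fun Ly (F : GaugeConfig d L G ≃ᵐ GaugeConfig d L G) => Ly.1.trans F) (MeasurableEquiv.refl (GaugeConfig d L G))) A') e = ((layers.foldr (fun Ly (F : GaugeConfig d L G ≃ᵐ GaugeConfig d L G) => Ly.1.trans F) (MeasurableEquiv.refl (GaugeConfig d L G))) A) e) := by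
  induction layers generalizing s A A' with
  | nil =>
    intro e he
    simp only [List.foldr_nil, MeasurableEquiv.refl_apply]
    exact h e (by simpa using he)
  | cons Ly rest ih =>
    intro e he
    simp only [List.foldr_cons, MeasurableEquiv.coe_trans, Function.comp_apply]
    have hs : s + (Ly :: rest).length = (s + 1) + rest.length := by
      simp only [List.length_cons]; ring
    rw [hs] at he
    exact ih (fun L hL => hloc L (List.mem_cons_of_mem _ hL))
      (local_off (hloc Ly List.mem_cons_self) h) e he

/-- **THE CROSS IDENTITY FOR THE RUNNING DENSITY.**  One-local layers whose densities satisfy the cross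
identity: if `A', B'` agree on the `(s + 2K + e₀)`-ball at `x₀`, `A, B` too, `A'` is `A` off the
`s`-ball and `B'` is `B` off the `s`-ball, then `J(A')·J(B) = J(A)·J(B')` for the running density
`J(v) = J_1(v)·J_2(F_1 v)⋯` (each layer consumes one unit of agreement and one unit of "off"). -/
theorem foldr_logDet_cross (layers : List ((GaugeConfig d L G ≃ᵐ GaugeConfig d L G) × (GaugeConfig d L G → ℝ)))
    (hloc : ∀ Ly ∈ layers, (∀ (U U' : GaugeConfig d L G) (x : Site d L) (r : ℕ),
      (∀ e : Edge d L, (∃ z : Fin d → ℤ, (∀ i, |z i| ≤ (((r+1) : ℕ) : ℤ)) ∧ e.1 = x + fun i => ((z i : ℤ) : ZMod L)) → U e = U' e) →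
      (∀ e : Edge d L, (∃ z : Fin d → ℤ, (∀ i, |z i| ≤ ((r : ℕ) : ℤ)) ∧ e.1 = x + fun i => ((z i : ℤ) : ZMod L)) → (Ly.1 U) e = (Ly.1 U') e)))
    (hJ : ∀ Ly ∈ layers, (∀ (A A' B B' : GaugeConfig d L G) (x₀ : Site d L) (r s : ℕ), s + 2 ≤ r →
      (∀ e : Edge d L, (∃ z : Fin d → ℤ, (∀ i, |z i| ≤ ((r : ℕ) : ℤ)) ∧ e.1 = x₀ + fun i => ((z i : ℤ) : ZMod L)) → A' e = B' e) →
      (∀ e : Edge d L, (∃ z : Fin d → ℤ, (∀ i, |z i| ≤ ((r : ℕ) : ℤ)) ∧ e.1 = x₀ + fun i => ((z i : ℤ) : ZMod L)) → A e = B e) →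
      (∀ e : Edge d L, ¬ (∃ z : Fin d → ℤ, (∀ i, |z i| ≤ ((s : ℕ) : ℤ)) ∧ e.1 = x₀ + fun i => ((z i : ℤ) : ZMod L)) → A' e = A e) →
      (∀ e : Edge d L, ¬ (∃ z : Fin d → ℤ, (∀ i, |z i| ≤ ((s : ℕ) : ℤ)) ∧ e.1 = x₀ + fun i => ((z i : ℤ) : ZMod L)) → B' e = B e) → Ly.2 A' * Ly.2 B = Ly.2 A * Ly.2 B'))
    (s e₀ : ℕ) (A A' B B' : GaugeConfig d L G) (x₀ : Site d L)
    (h1 : (∀ e : Edge d L, (∃ z : Fin d → ℤ, (∀ i, |z i| ≤ (((s+2*layers.length+e₀) : ℕ) : ℤ)) ∧ e.1 = x₀ + fun i => ((z i : ℤ) : ZMod L)) → A' e = B' e))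
    (h2 : (∀ e : Edge d L, (∃ z : Fin d → ℤ, (∀ i, |z i| ≤ (((s+2*layers.length+e₀) : ℕ) : ℤ)) ∧ e.1 = x₀ + fun i => ((z i : ℤ) : ZMod L)) → A e = B e))
    (h3 : (∀ e : Edge d L, ¬ (∃ z : Fin d → ℤ, (∀ i, |z i| ≤ ((s : ℕ) : ℤ)) ∧ e.1 = x₀ + fun i => ((z i : ℤ) : ZMod L)) → A' e = A e)) (h4 : (∀ e : Edge d L, ¬ (∃ z : Fin d → ℤ, (∀ i, |z i| ≤ ((s : ℕ) : ℤ)) ∧ e.1 = x₀ + fun i => ((z i : ℤ) : ZMod L)) → B' e = B e)) :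
    (layers.foldr (fun Ly K => fun v => Ly.2 v * K (Ly.1 v)) (fun _ => (1 : ℝ))) A' * (layers.foldr (fun Ly K => fun v => Ly.2 v * K (Ly.1 v)) (fun _ => (1 : ℝ))) B = (layers.foldr (fun Ly K => fun v => Ly.2 v * K (Ly.1 v)) (fun _ => (1 : ℝ))) A * (layers.foldr (fun Ly K => fun v => Ly.2 v * K (Ly.1 v)) (fun _ => (1 : ℝ))) B' := by
  induction layers generalizing s A A' B B' with
  | nil => simp only [List.foldr_nil]
  | cons Ly rest ih =>
    simp only [List.foldr_cons]
    have hr : s + 2 * (Ly :: rest).length + e₀ = (s + 2 * rest.length + e₀ + 1) + 1 := by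
      simp only [List.length_cons]; ring
    rw [hr] at h1 h2
    have hJ0 := hJ Ly List.mem_cons_self A A' B B' x₀ (s + 2 * rest.length + e₀ + 1 + 1) s (by omega) h1 h2 h3 h4
    have hA := hloc Ly List.mem_cons_self A' B' x₀ (s + 2 * rest.length + e₀ + 1) h1
    have hB := hloc Ly List.mem_cons_self A B x₀ (s + 2 * rest.length + e₀ + 1) h2
    have hr' : s + 2 * rest.length + e₀ + 1 = (s + 1) + 2 * rest.length + e₀ := by ring
    rw [hr'] at hA hB
    have hrest := ih (fun L hL => hloc L (List.mem_cons_of_mem _ hL))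
      (fun L hL => hJ L (List.mem_cons_of_mem _ hL)) (s + 1) (Ly.1 A) (Ly.1 A') (Ly.1 B) (Ly.1 B') hA hB
      (local_off (hloc Ly List.mem_cons_self) h3) (local_off (hloc Ly List.mem_cons_self) h4)
    rw [mul_mul_mul_comm, hJ0, hrest, mul_mul_mul_comm]

end Layers

/-! ## §3 Any group: the cross identity for the Wilson action -/

section Wilson

variable {d L : ℕ} {G : Type*} [Group G]

/-- A plaquette holonomy at `x` only reads links at sites `1`-near `x`. -/
theorem plaquetteHolonomy_congr {U U' : GaugeConfig d L G} {x : Site d L}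
    (h : (∀ e : Edge d L, (∃ z : Fin d → ℤ, (∀ i, |z i| ≤ ((1 : ℕ) : ℤ)) ∧ e.1 = x + fun i => ((z i : ℤ) : ZMod L)) → U e = U' e)) (i j : Fin d) :
    plaquetteHolonomy U x i j = plaquetteHolonomy U' x i j := by
  unfold plaquetteHolonomy
  rw [h (x, i) (near_refl x 1), h (Site.shift x i, j) (near_shift x i), h (Site.shift x j, i) (near_shift x j),
    h (x, j) (near_refl x 1)]

variable [NeZero L]

/-- **THE CROSS IDENTITY FOR THE WILSON ACTION** (any group, any matrix representation): for
`s + 2 ≤ r`, if `A', B'` agree on the `r`-ball at `x₀`, `A, B` too, `A'` is `A` off the `s`-ball and `B'`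
is `B` off the `s`-ball, then `S_W(A') − S_W(B') = S_W(A) − S_W(B)` — plaquettes near `x₀` contribute
zero to both sides, plaquettes far from `x₀` contribute equally. -/
theorem wilsonAction_cross {n : ℕ} (ρ : G →* Matrix (Fin n) (Fin n) ℂ) {A A' B B' : GaugeConfig d L G}
    {x₀ : Site d L} {r s : ℕ} (hrs : s + 2 ≤ r)
    (h1 : (∀ e : Edge d L, (∃ z : Fin d → ℤ, (∀ i, |z i| ≤ ((r : ℕ) : ℤ)) ∧ e.1 = x₀ + fun i => ((z i : ℤ) : ZMod L)) → A' e = B' e)) (h2 : (∀ e : Edge d L, (∃ z : Fin d → ℤ, (∀ i, |z i| ≤ ((r : ℕ) : ℤ)) ∧ e.1 = x₀ + fun i => ((z i : ℤ) : ZMod L)) → A e = B e))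
    (h3 : (∀ e : Edge d L, ¬ (∃ z : Fin d → ℤ, (∀ i, |z i| ≤ ((s : ℕ) : ℤ)) ∧ e.1 = x₀ + fun i => ((z i : ℤ) : ZMod L)) → A' e = A e)) (h4 : (∀ e : Edge d L, ¬ (∃ z : Fin d → ℤ, (∀ i, |z i| ≤ ((s : ℕ) : ℤ)) ∧ e.1 = x₀ + fun i => ((z i : ℤ) : ZMod L)) → B' e = B e)) :
    wilsonAction ρ A' - wilsonAction ρ B' = wilsonAction ρ A - wilsonAction ρ B := by
  unfold wilsonAction
  rw [← Finset.sum_sub_distrib, ← Finset.sum_sub_distrib]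
  refine Finset.sum_congr rfl fun p _ => ?_
  by_cases hn : (∃ z : Fin d → ℤ, (∀ i, |z i| ≤ (((s+1) : ℕ) : ℤ)) ∧ p.1 = x₀ + fun i => ((z i : ℤ) : ZMod L))
  · have hA : (∀ e : Edge d L, (∃ z : Fin d → ℤ, (∀ i, |z i| ≤ ((1 : ℕ) : ℤ)) ∧ e.1 = p.1 + fun i => ((z i : ℤ) : ZMod L)) → A' e = B' e) := fun e he =>
      h1 e (near_mono (by omega) (near_triangle hn he))
    have hB : (∀ e : Edge d L, (∃ z : Fin d → ℤ, (∀ i, |z i| ≤ ((1 : ℕ) : ℤ)) ∧ e.1 = p.1 + fun i => ((z i : ℤ) : ZMod L)) → A e = B e) := fun e he =>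
      h2 e (near_mono (by omega) (near_triangle hn he))
    rw [plaquetteHolonomy_congr hA, plaquetteHolonomy_congr hB, sub_self, sub_self]
  · have hA : (∀ e : Edge d L, (∃ z : Fin d → ℤ, (∀ i, |z i| ≤ ((1 : ℕ) : ℤ)) ∧ e.1 = p.1 + fun i => ((z i : ℤ) : ZMod L)) → A' e = A e) := fun e he =>
      h3 e fun hc => hn (near_triangle hc (near_symm he))
    have hB : (∀ e : Edge d L, (∃ z : Fin d → ℤ, (∀ i, |z i| ≤ ((1 : ℕ) : ℤ)) ∧ e.1 = p.1 + fun i => ((z i : ℤ) : ZMod L)) → B' e = B e) := fun e he =>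
      h4 e fun hc => hn (near_triangle hc (near_symm he))
    rw [plaquetteHolonomy_congr hA, plaquetteHolonomy_congr hB]

end Wilson

/-! ## §4 The cross identity for sums of site-local observables

(Appended, GEN-15.)  The Wilson action is one instance of a sum over sites of observables that read the
`1`-ball at their site; the cross identity holds for every such sum (the flowed action densities, local
log-det sums, improved actions), with the same proof. -/

section LocalSum

variable {d L : ℕ} {G : Type*} {M : Type*} [AddCommGroup M] [NeZero L]

/-- **THE CROSS IDENTITY FOR A SUM OF SITE-LOCAL OBSERVABLES**: if every `g x` reads the field on the
`1`-ball at `x` only, then for `s + 2 ≤ r`, fields with `A' ~ B'` and `A ~ B` on the `r`-ball at `x₀` and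
`A' = A`, `B' = B` off the `s`-ball satisfy `Σ_x g x A' − Σ_x g x B' = Σ_x g x A − Σ_x g x B`
(`wilsonAction_cross` is the case `g x U = Σ_{i<j} (N − Re tr U_p(x;i,j))`). -/
theorem localSum_cross (g : Site d L → GaugeConfig d L G → M)
    (hg : ∀ (x : Site d L) (U U' : GaugeConfig d L G), (∀ e : Edge d L, (∃ z : Fin d → ℤ, (∀ i, |z i| ≤ ((1 : ℕ) : ℤ)) ∧ e.1 = x + fun i => ((z i : ℤ) : ZMod L)) → U e = U' e) → g x U = g x U')
    {A A' B B' : GaugeConfig d L G} {x₀ : Site d L} {r s : ℕ} (hrs : s + 2 ≤ r)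
    (h1 : (∀ e : Edge d L, (∃ z : Fin d → ℤ, (∀ i, |z i| ≤ ((r : ℕ) : ℤ)) ∧ e.1 = x₀ + fun i => ((z i : ℤ) : ZMod L)) → A' e = B' e)) (h2 : (∀ e : Edge d L, (∃ z : Fin d → ℤ, (∀ i, |z i| ≤ ((r : ℕ) : ℤ)) ∧ e.1 = x₀ + fun i => ((z i : ℤ) : ZMod L)) → A e = B e))
    (h3 : (∀ e : Edge d L, ¬ (∃ z : Fin d → ℤ, (∀ i, |z i| ≤ ((s : ℕ) : ℤ)) ∧ e.1 = x₀ + fun i => ((z i : ℤ) : ZMod L)) → A' e = A e)) (h4 : (∀ e : Edge d L, ¬ (∃ z : Fin d → ℤ, (∀ i, |z i| ≤ ((s : ℕ) : ℤ)) ∧ e.1 = x₀ + fun i => ((z i : ℤ) : ZMod L)) → B' e = B e)) :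
    ∑ x, g x A' - ∑ x, g x B' = ∑ x, g x A - ∑ x, g x B := by
  rw [← Finset.sum_sub_distrib, ← Finset.sum_sub_distrib]
  refine Finset.sum_congr rfl fun x _ => ?_
  by_cases hn : (∃ z : Fin d → ℤ, (∀ i, |z i| ≤ (((s+1) : ℕ) : ℤ)) ∧ x = x₀ + fun i => ((z i : ℤ) : ZMod L))
  · rw [hg x A' B' (fun e he => h1 e (near_mono (by omega) (near_triangle hn he))),
      hg x A B (fun e he => h2 e (near_mono (by omega) (near_triangle hn he))), sub_self, sub_self]
  · rw [hg x A' A (fun e he => h3 e fun hc => hn (near_triangle hc (near_symm he))),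
      hg x B' B (fun e he => h4 e fun hc => hn (near_triangle hc (near_symm he)))]

end LocalSum

end Summit.Ventures.LatticeQCDFlow.Exactness
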